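import Literature.Analysis.FluidPDE.LerayEnstrophyAPrioriHolds
import Summits.NavierStokesRegularity.NavierStokesRegularity.Theorems.CertifiedBlowupCertifiedBlowupAxisymBlowupAmplificationOfKato
import Summits.NavierStokesRegularity.NavierStokesRegularity.Theorems.CertifiedBlowupCertifiedBlowupAxisymBlowupBKM
import HarnessLib

/-!
# Leray's enstrophy blow-up rate for every witness of the crux `CertifiedBlowupAxisymBlowup`

Theorems file landed `--supports stmt-NavierStokesRegularity-0727`, line `compact-amplification`
(continuation lead c3, wave 2; registered stub `enstrophy_rate_of_isMaximalSmoothSolution`). A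
witness of the crux is a viscosity `ν > 0`, a time `T > 0` and a maximal smooth solution `(u, p)` of
the unforced Navier–Stokes system of lifespan `T` (`IsMaximalSmoothSolution ν 0 u p T`), Leray–Hopf
on `[0, T]` from its rapidly decaying axisymmetric datum `u 0`. Leray 1934, §20 (3.12) ("un second
caractère des irrégularités"): the enstrophy of a solution which becomes irregular at the time `T`
satisfies `∫ |∇u(t)|² ≥ c ν^{3/2} (T - t)^{-1/2}` — the quantitative form of the landed enstrophy
blow-up `exists_enstrophy_gt_of_isMaximalSmoothSolution`, and the `H¹` companion of Leray's velocity
rates (`leray_rates_of_isMaximalSmoothSolution`). This file proves it at the crux, kernel-checked and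
unconditional, from the proved enstrophy a priori bound with lifespan `leray_enstrophy_apriori_holds`
(Robinson–Rodrigo–Sadowski 2016, (6.6)–(6.10), Cor. 6.9: `∫|∇u(0)|² ≤ A`, `A² T ≤ c ν³` ⟹
`∫|∇u(t)|² ≤ K A` on `[0, T]`, for classical solutions in Tao's smooth `H¹` class):

* `lintegral_frobeniusNormSq_le_before_of_lerayHopf_classical`: the enstrophy (Frobenius form) of a
  classical Leray–Hopf solution from a rapidly decaying datum is bounded on every earlier closed slab
  `[0, T'']`, `T'' < T` (the solution is in the Beale–Kato–Majda class there,
  `hasBoundedSobolevNormsOn_before_of_lerayHopf_classical`);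
* `lintegral_frobeniusNormSq_le_after_of_isMaximalSmoothSolution`: the a priori step at the crux —
  if `∫|∇u(t₀)|² ≤ A` at some `t₀ ∈ [0, T)` with `A² (T - t₀) ≤ c ν³`, then `∫|∇u(t)|² ≤ K A` for
  all `t ∈ [t₀, T)` (restart the Tao-class development of the datum at `t₀`,
  `IsTaoSolutionOn.translate`, and apply `leray_enstrophy_apriori_holds` on `[t₀, T']`, `T' < T`);
* `enstrophy_rate_of_isMaximalSmoothSolution` (the registered stub): hence
  `∫|∇u(t)|² ≥ √c · ν^{3/2} / √(T - t)` for every witness and every `t ∈ [0, T)` — otherwise the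
  enstrophy, and with the Leray–Hopf energy inequality the full `H¹` norm, stays bounded on `[0, T)`,
  and the `H¹` continuation criterion `hasSobolevExtensionPast_of_uniform_H1_bound`
  (Constantin–Fefferman; Lemarié-Rieusset 2016, Thm. 11.7) continues `u` past `T`, contradicting
  maximality (Robinson–Rodrigo–Sadowski 2016, Lemma 6.14 with Cor. 6.9).

No new definitions, no named-fact hypotheses, no `sorry`. The axisymmetry of the datum is not used.

## References

* J. Leray, *Sur le mouvement d'un liquide visqueux emplissant l'espace*, Acta Math. 63 (1934),
  193–248: §19 (3.8) p. 224, §20 (3.12) p. 225. [Leray1934]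
* J. C. Robinson, J. L. Rodrigo, W. Sadowski, *The Three-Dimensional Navier–Stokes Equations*,
  CUP 2016: Thm. 6.8 (proof, (6.6)–(6.10)), Cor. 6.9, Lemma 6.14. [RobinsonRodrigoSadowski2016]
* P. G. Lemarié-Rieusset, *The Navier–Stokes Problem in the 21st Century*, CRC 2016, Thm. 7.2,
  Thm. 11.7, Prop. 12.3. [LemarieRieusset2016]
-/

-- the summit and its single problem share the name (D-0017 nested layout)
set_option linter.dupNamespace false

noncomputable section

open MeasureTheory Set Function Filter Topology Metric
open scoped ENNReal NNReal

namespace Summit.NavierStokesRegularity.NavierStokesRegularity.Theorems.CertifiedBlowupAxisymBlowup.CompactAmplification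

open Literature.Analysis.FluidPDE

section Witness

variable {ν T : ℝ} {u : ℝ → (EuclideanSpace ℝ (Fin 3)) → (EuclideanSpace ℝ (Fin 3))} {p : ℝ → (EuclideanSpace ℝ (Fin 3)) → ℝ}

/-- **The enstrophy of a classical Leray–Hopf solution from a rapidly decaying datum is bounded on
every earlier closed slab** `[0, T'']`, `T'' < T` (Frobenius form `∫ |∇u(t)|²`): the solution lies
in the Beale–Kato–Majda class there (`hasBoundedSobolevNormsOn_before_of_lerayHopf_classical`,
order `n = 1`, `‖D¹u‖ = ‖∇u‖`), and `|L|² ≤ 3 ‖L‖²` on `ℝ³`. [folklore] -/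
theorem lintegral_frobeniusNormSq_le_before_of_lerayHopf_classical (hν : 0 < ν) (hT : 0 < T)
    (hcl : IsClassicalNSSolutionOn (Ico 0 T) ν 0 u p) (hLH : IsLerayHopfOn T ν 0 (u 0) u)
    (hdec : HasRapidSpatialDecay (u 0)) {T'' : ℝ} (hT'' : T'' < T) :
    ∃ B : ℝ, 0 ≤ B ∧ ∀ t ∈ Icc 0 T'',
      (∫⁻ x, ENNReal.ofReal (frobeniusNormSq (fderiv ℝ (u t) x))) ≤ ENNReal.ofReal B := by
  obtain ⟨C, hC⟩ :=
    hasBoundedSobolevNormsOn_before_of_lerayHopf_classical hν hT hcl hLH hdec T'' hT'' 1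
  refine ⟨3 * C, by positivity, fun t ht => ?_⟩
  calc (∫⁻ x, ENNReal.ofReal (frobeniusNormSq (fderiv ℝ (u t) x)))
      ≤ ∫⁻ x, 3 * ‖fderiv ℝ (u t) x‖ₑ ^ 2 :=
        lintegral_mono fun x => ofReal_frobeniusNormSq_le_three_mul_enorm_sq _
    _ = 3 * ∫⁻ x, ‖iteratedFDeriv ℝ 1 (u t) x‖ₑ ^ 2 := by
        rw [lintegral_const_mul' _ _ (by norm_num)]
        congr 1
        exact lintegral_congr fun x => by rw [enorm_iteratedFDeriv_one]
    _ ≤ 3 * (C : ℝ≥0∞) := by gcongr; exact hC t ht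
    _ = ENNReal.ofReal (3 * C) := by
        rw [ENNReal.ofReal_mul (by norm_num), ENNReal.ofReal_ofNat, ENNReal.ofReal_coe_nnreal]

/-- **Leray's a priori step at the crux** (Robinson–Rodrigo–Sadowski 2016, (6.9) and Cor. 6.9, in
the form `leray_enstrophy_apriori_holds`, transported to a maximal Leray–Hopf classical solution):
if `∫ |∇u(t₀)|² ≤ A` at some `t₀ ∈ [0, T)` and `A² (T - t₀) ≤ c ν³`, then `∫ |∇u(t)|² ≤ K A` for
every `t ∈ [t₀, T)`. For `t₀ ≤ t < T' < T` the solution agrees on `[0, T']` with the Tao-class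
development `(U, P)` of its datum (`exists_isTaoSolutionOn_of_isMaximalSmoothSolution`), whose
restart at `t₀` (`IsTaoSolutionOn.translate`) is a classical solution in the smooth `H¹` class on
`[0, T' - t₀]` from `u t₀`, with `A² (T' - t₀) ≤ A² (T - t₀) ≤ c ν³`.
[cite: RobinsonRodrigoSadowski2016, Cor. 6.9 and Lemma 6.14] -/
theorem lintegral_frobeniusNormSq_le_after_of_isMaximalSmoothSolution {c K : ℝ}
    (hap : LerayEnstrophyAPrioriWith c K) (hν : 0 < ν) (hT : 0 < T)
    (hmax : IsMaximalSmoothSolution ν 0 u p T) (hLH : IsLerayHopfOn T ν 0 (u 0) u)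
    (hdec : HasRapidSpatialDecay (u 0)) {t₀ : ℝ} (ht₀ : t₀ ∈ Ico 0 T) {A : ℝ} (hA0 : 0 ≤ A)
    (hAt₀ : (∫⁻ x, ENNReal.ofReal (frobeniusNormSq (fderiv ℝ (u t₀) x))) ≤ ENNReal.ofReal A)
    (hsmall : A ^ 2 * (T - t₀) ≤ c * ν ^ 3) :
    ∀ t ∈ Ico t₀ T,
      (∫⁻ x, ENNReal.ofReal (frobeniusNormSq (fderiv ℝ (u t) x))) ≤ ENNReal.ofReal (K * A) := by
  intro t ht
  -- an intermediate time `t < T' < T`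
  set T' : ℝ := (t + T) / 2 with hT'_def
  have htT' : t < T' := by rw [hT'_def]; linarith [ht.2]
  have hT'T : T' < T := by rw [hT'_def]; linarith [ht.2]
  have ht₀T' : t₀ < T' := lt_of_le_of_lt ht.1 htT'
  have hT'0 : 0 < T' := lt_of_le_of_lt ht₀.1 ht₀T'
  have hpos : 0 < T' - t₀ := sub_pos.2 ht₀T'
  -- the Tao-class development on `[0, T']` and its restart at `t₀`
  obtain ⟨U, P, hU, hUeq⟩ :=
    exists_isTaoSolutionOn_of_isMaximalSmoothSolution hν hT hmax hLH hdec hT'0 hT'T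
  have hV := hU.translate ht₀.1 ht₀T'
  have hinit : (∫⁻ x, ENNReal.ofReal
      (frobeniusNormSq (fderiv ℝ ((fun s => U (s + t₀)) 0) x))) ≤ ENNReal.ofReal A := by
    simp only [zero_add]
    rw [hUeq t₀ ⟨ht₀.1, ht₀T'.le⟩]
    exact hAt₀
  have hsmall' : A ^ 2 * (T' - t₀) ≤ c * ν ^ 3 :=
    le_trans (mul_le_mul_of_nonneg_left (by linarith) (sq_nonneg A)) hsmall
  have h := (hap hν hpos hV.classical hV.sobolev hV.sobolev_dt hV.sobolev_p hA0 hinit hsmall').1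
    (t - t₀) ⟨sub_nonneg.2 ht.1, by linarith⟩
  simp only [sub_add_cancel] at h
  rw [hUeq t ⟨ht₀.1.trans ht.1, htT'.le⟩] at h
  exact h

end Witness

/-- **Leray's enstrophy blow-up rate for every witness of the crux** (registered stub of
stmt-NavierStokesRegularity-0727; Leray 1934, §20 (3.12): "un second caractère des irrégularités").
There is an absolute constant `c > 0` such that for every maximal Leray–Hopf classical solution
`(u, p)` of viscosity `ν > 0` and finite lifespan `T > 0` from a rapidly decaying axisymmetric datum
and every `t ∈ [0, T)`, `∫ |∇u(t)|² ≥ c ν^{3/2} / √(T - t)`. Proof: with `c₀, K` the constants of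
`leray_enstrophy_apriori_holds` take `c = √c₀`, so that `A = √c₀ ν^{3/2}/√(T - t)` has
`A² (T - t) = c₀ ν³`. Were `∫ |∇u(t)|² < A`, the enstrophy would stay `≤ K A` on `[t, T)`
(`lintegral_frobeniusNormSq_le_after_of_isMaximalSmoothSolution`); it is bounded on `[0, t]`
(`lintegral_frobeniusNormSq_le_before_of_lerayHopf_classical`) and the energy is bounded by the
Leray–Hopf energy inequality, so the `H¹` continuation criterion
`hasSobolevExtensionPast_of_uniform_H1_bound` continues `u` in the Beale–Kato–Majda class past `T`,
contradicting maximality. The axisymmetry of the datum is not used.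
[cite: Leray1934, §20 (3.12) p. 225 and §19 (3.8)]
[cite: RobinsonRodrigoSadowski2016, Cor. 6.9 and Lemma 6.14] -/
theorem enstrophy_rate_of_isMaximalSmoothSolution : ∃ c : ℝ, 0 < c ∧ ∀ {ν T : ℝ} {u : ℝ → EuclideanSpace ℝ (Fin 3) → EuclideanSpace ℝ (Fin 3)} {p : ℝ → EuclideanSpace ℝ (Fin 3) → ℝ}, 0 < ν → 0 < T → IsMaximalSmoothSolution ν 0 u p T → IsLerayHopfOn T ν 0 (u 0) u → HasRapidSpatialDecay (u 0) → IsAxisymmetric (u 0) → ∀ t ∈ Set.Ico 0 T, ENNReal.ofReal (c * ν ^ (3 / 2 : ℝ) / Real.sqrt (T - t)) ≤ ∫⁻ x, ENNReal.ofReal (frobeniusNormSq (fderiv ℝ (u t) x)) := by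
  obtain ⟨c, K, hc, hK, hap⟩ := leray_enstrophy_apriori_holds
  refine ⟨Real.sqrt c, Real.sqrt_pos.2 hc, fun {ν T u p} hν hT hmax hLH hdec _ t₀ ht₀ => ?_⟩
  have hTt₀ : 0 < T - t₀ := sub_pos.2 ht₀.2
  set A : ℝ := Real.sqrt c * ν ^ (3 / 2 : ℝ) / Real.sqrt (T - t₀) with hA_def
  have hA0 : 0 ≤ A := by positivity
  have hA2 : A ^ 2 * (T - t₀) = c * ν ^ 3 := by
    have h32 : (ν ^ (3 / 2 : ℝ)) ^ 2 = ν ^ 3 := by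
      rw [← Real.rpow_two, ← Real.rpow_mul hν.le]
      norm_num
    rw [hA_def, div_pow, mul_pow, Real.sq_sqrt hc.le, Real.sq_sqrt hTt₀.le, h32,
      div_mul_cancel₀ _ hTt₀.ne']
  by_contra hlt
  rw [not_le] at hlt
  -- the enstrophy stays bounded on `[t₀, T)` (a priori step) and on `[0, t₀]` (BKM class)
  have hafter := lintegral_frobeniusNormSq_le_after_of_isMaximalSmoothSolution hap hν hT hmax hLH
    hdec ht₀ hA0 hlt.le hA2.le
  obtain ⟨B, hB0, hbefore⟩ :=
    lintegral_frobeniusNormSq_le_before_of_lerayHopf_classical hν hT hmax.1 hLH hdec ht₀.2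
  -- the energy is bounded by the Leray–Hopf energy inequality
  have hE : ∀ t ∈ Ico 0 T,
      ∫⁻ x, ‖u t x‖ₑ ^ 2 ≤ ENNReal.ofReal (2 * VectorCalculus.kineticEnergy (u 0)) :=
    fun t ht => hLH.lintegral_enorm_sq_le hν.le ⟨ht.1, ht.2.le⟩
  have hkin : 0 ≤ VectorCalculus.kineticEnergy (u 0) := kineticEnergy_nonneg _
  have hKA : 0 ≤ K * A := mul_nonneg hK.le hA0
  have hA'0 : 0 ≤ 2 * VectorCalculus.kineticEnergy (u 0) + (K * A + B) := by positivity
  have hA' : ∀ t ∈ Ico 0 T, (∫⁻ x, ‖u t x‖ₑ ^ 2) +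
      (∫⁻ x, ENNReal.ofReal (frobeniusNormSq (fderiv ℝ (u t) x))) ≤
        ENNReal.ofReal (2 * VectorCalculus.kineticEnergy (u 0) + (K * A + B)) := by
    intro t ht
    have h2 : (∫⁻ x, ENNReal.ofReal (frobeniusNormSq (fderiv ℝ (u t) x))) ≤
        ENNReal.ofReal (K * A + B) := by
      rcases lt_or_ge t t₀ with h | h
      · exact (hbefore t ⟨ht.1, h.le⟩).trans
          (ENNReal.ofReal_le_ofReal (le_add_of_nonneg_left hKA))
      · exact (hafter t ⟨h, ht.2⟩).trans
          (ENNReal.ofReal_le_ofReal (le_add_of_nonneg_right hB0))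
    rw [ENNReal.ofReal_add (by positivity) (add_nonneg hKA hB0)]
    exact add_le_add (hE t ht) h2
  -- `H¹` continuation past `T`, contradicting maximality
  have hreg : ∀ T'' < T, HasBoundedSobolevNormsOn (Icc 0 T'') u :=
    hasBoundedSobolevNormsOn_before_of_lerayHopf_classical hν hT hmax.1 hLH hdec
  have hext := hasSobolevExtensionPast_of_uniform_H1_bound hν hT hmax.1 hreg hA'0 hA'
  exact hmax.2 hext.hasSmoothExtensionPast

end Summit.NavierStokesRegularity.NavierStokesRegularity.Theorems.CertifiedBlowupAxisymBlowup.CompactAmplification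

end
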